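import Mathlib
import Summits.Ventures.PercRepro2.Tail2DBlockCalc

/-!
# Harris's inequality on the SP configuration type, and the block dominations it gives
(seat mine-b, cell pub-perc-repro2; conjectures/MINE-B.md §42)

The configurations of an SP term form a nested product of `Bool`s (and `Unit`s) with the product order, so the
Harris (FKG) inequality at `p = 1/2` holds by induction on the term: for monotone weights `f, g`,
`(Σ f) · (Σ g) ≤ (Σ f·g) · #Conf` (`harris_sp`), the product step being the classical two-stage argument
(fibre-wise on the second factor, then on the first factor for the fibre averages, which are monotone).
Consequences in the block calculus: every UPPER set dominates the whole configuration space (`blockDom_univ_upper`),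
the whole space dominates every LOWER set (`blockDom_lower_univ`), and hence every lower set is dominated by every
upper set through the whole space (`blockDom_lower_upper`).  These are the dominations the flow-1 parallel step
needs (`Tail2DFlowOnePar.lean`).
-/

namespace Summit.Ventures.PercRepro2.Tail2D

open V2Closure Finset

/-- the Harris inequality, function form, on a finite type with a preorder: a property of the type -/
def HarrisType (α : Type) [Preorder α] [Fintype α] : Prop :=
  ∀ f g : α → ℕ, Monotone f → Monotone g → (∑ x, f x) * (∑ x, g x) ≤ (∑ x, f x * g x) * Fintype.card α

/-- Harris on `Bool` (two points): `(f₀ + f₁)(g₀ + g₁) ≤ 2 (f₀ g₀ + f₁ g₁)` for increasing `f, g` -/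
theorem harrisType_bool : HarrisType Bool := by
  intro f g hf hg
  rw [Fintype.sum_bool, Fintype.sum_bool, Fintype.sum_bool, Fintype.card_bool]
  have h1 := hf (Bool.false_le true); have h2 := hg (Bool.false_le true)
  nlinarith [Nat.mul_le_mul h1 h2]

/-- Harris on `Unit` (one point) -/
theorem harrisType_unit : HarrisType Unit := by
  intro f g _ _
  simp

/-- Harris on a product of two Harris types (product order) -/
theorem harrisType_prod (α β : Type) [Preorder α] [Preorder β] [Fintype α] [Fintype β]
    (hα : HarrisType α) (hβ : HarrisType β) : HarrisType (α × β) := by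
  intro f g hf hg
  rw [Fintype.sum_prod_type, Fintype.sum_prod_type, Fintype.sum_prod_type, Fintype.card_prod]
  -- fibre-wise Harris on β: for each x, (Σ_y f(x,y)) (Σ_y g(x,y)) ≤ (Σ_y f g) * #β
  have hfy : ∀ x : α, Monotone (fun y : β => f (x, y)) := fun x y y' h => hf (Prod.mk_le_mk.2 ⟨le_rfl, h⟩)
  have hgy : ∀ x : α, Monotone (fun y : β => g (x, y)) := fun x y y' h => hg (Prod.mk_le_mk.2 ⟨le_rfl, h⟩)
  have fib : ∀ x : α, (∑ y, f (x, y)) * (∑ y, g (x, y)) ≤ (∑ y, f (x, y) * g (x, y)) * Fintype.card β :=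
    fun x => hβ _ _ (hfy x) (hgy x)
  -- the fibre sums are monotone in x
  have hF : Monotone (fun x : α => ∑ y, f (x, y)) :=
    fun x x' h => Finset.sum_le_sum (fun y _ => hf (Prod.mk_le_mk.2 ⟨h, le_rfl⟩))
  have hG : Monotone (fun x : α => ∑ y, g (x, y)) :=
    fun x x' h => Finset.sum_le_sum (fun y _ => hg (Prod.mk_le_mk.2 ⟨h, le_rfl⟩))
  have top := hα _ _ hF hG
  -- combine: (Σ_x F)(Σ_x G) ≤ (Σ_x F G) #α ≤ (Σ_x (Σ_y f g) #β) #α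
  have step : (∑ x, (∑ y, f (x, y)) * (∑ y, g (x, y))) ≤ ∑ x, (∑ y, f (x, y) * g (x, y)) * Fintype.card β :=
    Finset.sum_le_sum (fun x _ => fib x)
  calc (∑ x, ∑ y, f (x, y)) * (∑ x, ∑ y, g (x, y))
      ≤ (∑ x, (∑ y, f (x, y)) * (∑ y, g (x, y))) * Fintype.card α := top
    _ ≤ (∑ x, (∑ y, f (x, y) * g (x, y)) * Fintype.card β) * Fintype.card α := Nat.mul_le_mul_right _ step
    _ = (∑ x, ∑ y, f (x, y) * g (x, y)) * (Fintype.card α * Fintype.card β) := by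
        rw [← Finset.sum_mul]; ring

/-- **Harris's inequality on every SP configuration type** -/
theorem harris_sp : ∀ s : V2Closure.SP, HarrisType s.Conf
  | .free => harrisType_bool
  | .pin => harrisType_unit
  | .absent => harrisType_unit
  | .ser s t => harrisType_prod s.Conf t.Conf (harris_sp s) (harris_sp t)
  | .par s t => harrisType_prod s.Conf t.Conf (harris_sp s) (harris_sp t)

section Blocks

variable (s : V2Closure.SP)

/-- the indicator of a set is monotone when the set is an upper set -/
theorem monotone_indicator_of_upper (U : Finset s.Conf) (hU : ∀ x y, x ≤ y → x ∈ U → y ∈ U) :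
    Monotone (fun x : s.Conf => if x ∈ U then 1 else 0) := by
  intro x y hxy
  by_cases hx : x ∈ U
  · simp [hx, hU x y hxy hx]
  · simp [hx]

/-- the block sum over `U` is the sum of `f` against the indicator of `U` -/
theorem blockSum_eq_sum_indicator (U : Finset s.Conf) (f : s.Conf → ℕ) :
    blockSum s U f = ∑ x, f x * (if x ∈ U then 1 else 0) := by
  unfold blockSum
  rw [show (∑ x, f x * (if x ∈ U then 1 else 0)) = ∑ x, (if x ∈ U then f x else 0) from
    Finset.sum_congr rfl (fun x _ => by split_ifs <;> simp)]
  rw [Finset.sum_ite_mem, Finset.univ_inter]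

/-- a configuration of every term (all edges red) -/
def redConf : ∀ s : V2Closure.SP, s.Conf
  | .free => false
  | .pin => ()
  | .absent => ()
  | .ser s t => (redConf s, redConf t)
  | .par s t => (redConf s, redConf t)

/-- the configuration space is non-empty -/
theorem univ_nonempty_conf : (Finset.univ : Finset s.Conf).Nonempty := ⟨redConf s, Finset.mem_univ _⟩

/-- **the whole space is dominated by every upper set** (Harris) -/
theorem blockDom_univ_upper (U : Finset s.Conf) (hU : ∀ x y, x ≤ y → x ∈ U → y ∈ U) :
    BlockDom s Finset.univ U := by
  intro f hf
  have h := harris_sp s f (fun x => if x ∈ U then 1 else 0) hf (monotone_indicator_of_upper s U hU)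
  have e1 : (∑ x, (if x ∈ U then 1 else 0 : ℕ)) = U.card := by
    rw [Finset.sum_boole]; simp
  have e2 : (∑ x, f x * (if x ∈ U then 1 else 0 : ℕ)) = blockSum s U f := (blockSum_eq_sum_indicator s U f).symm
  rw [e1, e2] at h
  simpa [blockSum, Finset.card_univ] using h

/-- **every lower set is dominated by the whole space** (Harris for a decreasing indicator) -/
theorem blockDom_lower_univ (D : Finset s.Conf) (hD : ∀ x y, x ≤ y → y ∈ D → x ∈ D) :
    BlockDom s D Finset.univ := by
  intro f hf
  -- the indicator of the complement of `D` is monotone; apply Harris to `f` and it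
  have hUc : ∀ x y, x ≤ y → x ∈ Dᶜ → y ∈ Dᶜ := by
    intro x y hxy hx
    simp only [Finset.mem_compl] at hx ⊢
    exact fun hy => hx (hD x y hxy hy)
  have h := harris_sp s f (fun x => if x ∈ Dᶜ then 1 else 0) hf (monotone_indicator_of_upper s Dᶜ hUc)
  have e1 : (∑ x, (if x ∈ Dᶜ then 1 else 0 : ℕ)) = Fintype.card s.Conf - D.card := by
    rw [Finset.sum_boole]
    simp only [Nat.cast_id]
    rw [Finset.filter_mem_eq_inter, Finset.univ_inter]
    exact Finset.card_compl D
  have e2 : (∑ x, f x * (if x ∈ Dᶜ then 1 else 0 : ℕ)) = (∑ x, f x) - blockSum s D f := by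
    rw [blockSum_eq_sum_indicator]
    have : ∀ x, f x * (if x ∈ Dᶜ then 1 else 0 : ℕ) = f x - f x * (if x ∈ D then 1 else 0) := by
      intro x; by_cases hx : x ∈ D <;> simp [hx]
    simp_rw [this]
    rw [Finset.sum_tsub_distrib]
    intro x _; by_cases hx : x ∈ D <;> simp [hx]
  rw [e1, e2] at h
  have hD' : D.card ≤ Fintype.card s.Conf := by rw [← Finset.card_univ]; exact Finset.card_le_univ D
  have hf' : blockSum s D f ≤ ∑ x, f x := by
    unfold blockSum; exact Finset.sum_le_sum_of_subset_of_nonneg (Finset.subset_univ D) (fun _ _ _ => Nat.zero_le _)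
  show blockSum s D f * (Finset.univ : Finset s.Conf).card ≤ (∑ x, f x) * D.card
  rw [Finset.card_univ]
  zify [hD', hf'] at h ⊢
  nlinarith [h]

/-- **every lower set is dominated by every upper set** (through the whole space) -/
theorem blockDom_lower_upper (D U : Finset s.Conf) (hD : ∀ x y, x ≤ y → y ∈ D → x ∈ D)
    (hU : ∀ x y, x ≤ y → x ∈ U → y ∈ U) : BlockDom s D U :=
  blockDom_trans s (univ_nonempty_conf s) (blockDom_lower_univ s D hD) (blockDom_univ_upper s U hU)

end Blocks

end Summit.Ventures.PercRepro2.Tail2D
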